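import Summits.QuantumFields.BalabanUV.Beta.GAN24.DirichletRingLayerCake

/-!
# `BalabanUV.Beta.GAN24.DirichletRingHessianLocal` — binder row G-an2-4 / (CONV-C), road P2 PART IV, leaf L14 (the torus transfer),
# model brick: THE LOCAL `H²` ESTIMATE AT A BLOCK VERTEX WHOSE REGION IS AXIS-SEPARATED (block interior, flat face, convex corner,
# and — after splitting — each half of a checkerboard vertex) (unit b2b-balaban-gan24-p2, gen 26, v1)

HONEST FRAMING (cell contract, verbatim): «discharging `BetaPertH` makes Bałaban's UV stability UNCONDITIONAL — a real constructive-QFT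
result; it is NOT the continuum limit and NOT the Clay problem.»  SUPPLIER brick under the T⁴-DAG sub-row `T4-U1a.S-NE2-D1-DIRICHLET°`
(holder: the t4-ne2-p1 lineage; owner wording R24 «the full rate L⁻¹ beyond boxes OPEN»), MODEL coordinates (`ℤ²` around one block vertex,
lattice units).  Binder (A) on the torus (leaf L14) is assembled vertex by vertex: the dyadic neighbourhoods of RE-ENTRANT vertices carry
the distance weight and are served by `DirichletRingHessian.weighted_hessian_le` (p243612) / `DirichletVertexHessian`; every OTHER block
vertex (no block, one block = convex corner, two adjacent blocks = flat face, four blocks = interior, and two DIAGONAL blocks =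
checkerboard, the latter after splitting the field into its two quadrant pieces, which do not interact through the 5-point stencil) has a
pulled-back region `W ⊂ ℤ²` that is AXIS-SEPARATED: an exterior site has `W`-neighbours along at most one axis.  For such `W` the discrete
`H²` inequality holds with constant `1` and NO weight (this file), so these vertices contribute `O(‖f‖²)` to (A) with weight `≤ 1`.

## Contents ([folklore] finite sums; 0 sorry)

* §1 **`hessian_le_of_axis`**: for `z` supported well inside a box and a `{0,1}`-valued `χ` such that at every site with `χ = 0` one of
  `∂₁²z`, `∂₂²z` vanishes: `Σ_box χ·(|∂₁²z|² + |∂₂²z|²) ≤ Σ_box χ·|Δz|²` (`DirichletRingHessianIdentity.box_hessian_le` + a pointwise identity;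
  `hessian_le_offQuadrant` is the case `χ = offQ`).
* §2 `AxisSep W` ([shape]) and `indW`; the quadrant, the half-plane and the whole plane are axis-separated; for `z` vanishing off an
  axis-separated `W` the hypothesis of §1 holds with `χ = 𝟙_W`.
* §3 the plateau cut-off `bump L i j = (1 − η_L i)(1 − η_L j)` (`= 1` on `Q_{2L}`, `= 0` off `Q_{4L−1}`, `|δ bump| ≤ 1/L`, `|δ² bump| ≤ 1/L²`,
  from `DirichletRingCutoff`).
* §4 **`local_hessian_le`**: for `1 ≤ L`, `W` axis-separated, `U = 0` off `W` on `Q_{4L}`, `lap U = G` on `Q_{4L} ∩ W`: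
  `Σ_{Q_{2L−1}} 𝟙_W·(|∂₁²U|² + |∂₂²U|²) ≤ 2·Σ_{Q_{4L+1}} 𝟙_W·|G|² + (32/L²)·Ẽ_{4L+1} + (16/L⁴)·Σ_{Q_{4L+1}} |U|²`
  (`z = bump·U`; §1–§2; `|Δz|² ≤ 2|G|² + 2|[Δ, bump]U|²` on `W`; `DirichletRingCutoff.norm_commutator_sq_le`; `nbr_sqSum_le`).

ABSOLUTE RULE (cell, verbatim): «No internally-minted statement may enter as a cited fact. Every hypothesis is either kernel-proved in
this package or a verbatim quotation of a PUBLISHED theorem with page reference. The manuscript(s) under audit are NOT citable for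
their own disputed steps — they are the thing under adjudication; programme-internal (2001/route/tribunal) claims are never citable.»
Nothing printed is a hypothesis.  NOT CLAIMED: (A) on the torus (the push-forward and the vertex census are the next files), NE2, (CONV-C),
`BetaPertH`, continuum, Clay.  «not in print; our proof attempt».  HONEST DEPENDENCY: continuum YM on T⁴ ⇐ BetaPertH ∧ nine spine estimates
(0/9 proved); BetaPertH ⇐ (D1) ∧ (D4) ∧ CAP+tail; G-an2-4 gates asym, D1 and NE2/3/4.
-/

noncomputable section

open scoped BigOperators ComplexConjugate
open Finset

namespace Summit.QuantumFields.BalabanUV.Beta.GAN24.DirichletRingHessianLocal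

open DirichletRingEnergies (lap sqSum Et En Et_nonneg En_nonneg Rad_nonneg sqSum_nonneg sqSum_mono)
open DirichletRingCutoff (tIdx one_le_tIdx eta eta_mem eta_eq_zero eta_eq_one abs_eta_sub_le abs_eta_dd_le norm_commutator_sq_le)
open DirichletRingHessianIdentity (d1 d2 boxSum boxSum_sub boxSum_congr box_hessian_le lap_eq_neg)
open DirichletRingHessianWindow (rho nbr nbr_sqSum_le sqSum_le_of_le tIdx_step)
open DirichletRingLayerCake (sqSum_eq_of_vanish)

/-! ## §1 The `H²` inequality with an axis condition at the excluded sites -/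

/-- **`H²` WITH AN AXIS CONDITION**: for `z` supported well inside the box `[a, a+N+1)²` and `χ ∈ {0,1}` such that at every site with
`χ = 0` one of the two second differences of `z` vanishes, `Σ_box χ·(|∂₁²z|² + |∂₂²z|²) ≤ Σ_box χ·|Δz|²`. [folklore] -/
theorem hessian_le_of_axis (z : ℤ → ℤ → ℂ) (χ : ℤ → ℤ → ℝ) (a : ℤ) (N : ℕ)
    (hz : ∀ i j : ℤ, (i < a + 2 ∨ a + N - 1 ≤ i ∨ j < a + 2 ∨ a + N - 1 ≤ j) → z i j = 0)
    (hχ : ∀ i j : ℤ, χ i j = 1 ∨ (χ i j = 0 ∧ (d1 z i j = 0 ∨ d2 z i j = 0))) :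
    boxSum (fun i j => χ i j * (‖d1 z i j‖ ^ 2 + ‖d2 z i j‖ ^ 2)) a (N + 1)
      ≤ boxSum (fun i j => χ i j * ‖lap z i j‖ ^ 2) a (N + 1) := by
  have hsplit : ∀ i j, χ i j * (‖d1 z i j‖ ^ 2 + ‖d2 z i j‖ ^ 2) - χ i j * ‖lap z i j‖ ^ 2
      = (‖d1 z i j‖ ^ 2 + ‖d2 z i j‖ ^ 2) - ‖lap z i j‖ ^ 2 := by
    intro i j
    rcases hχ i j with h | ⟨h, h'⟩
    · rw [h]; ring
    · rw [h, lap_eq_neg, norm_neg]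
      rcases h' with h1 | h2
      · rw [h1]; simp
      · rw [h2]; simp
  have hglob := box_hessian_le z a N hz
  have hdiff : boxSum (fun i j => χ i j * (‖d1 z i j‖ ^ 2 + ‖d2 z i j‖ ^ 2)) a (N + 1)
      - boxSum (fun i j => χ i j * ‖lap z i j‖ ^ 2) a (N + 1)
      = boxSum (fun i j => ‖d1 z i j‖ ^ 2 + ‖d2 z i j‖ ^ 2) a (N + 1) - boxSum (fun i j => ‖lap z i j‖ ^ 2) a (N + 1) := by
    rw [← boxSum_sub, ← boxSum_sub]
    exact boxSum_congr hsplit a (N + 1)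
  linarith [hdiff]

/-! ## §2 Axis-separated regions -/

/-- [shape] **AXIS-SEPARATED region of `ℤ²`**: every site outside `W` has no `W`-neighbour along the first axis, or none along the second
(the pulled-back region of a block vertex that is neither re-entrant nor checkerboard; each quadrant piece of a checkerboard vertex). [folklore] -/
def AxisSep (W : ℤ → ℤ → Prop) : Prop :=
  ∀ i j : ℤ, ¬ W i j → (¬ W (i + 1) j ∧ ¬ W (i - 1) j) ∨ (¬ W i (j + 1) ∧ ¬ W i (j - 1))

/-- **products are axis-separated**: `W = A × B` for ANY `A, B ⊂ ℤ` (quadrants, half-planes, strips, the whole plane). [folklore] -/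
theorem axisSep_prod (A B : ℤ → Prop) : AxisSep (fun i j => A i ∧ B j) := by
  intro i j h
  by_cases hi : A i
  · left
    have hj : ¬ B j := fun hj => h ⟨hi, hj⟩
    exact ⟨fun h' => hj h'.2, fun h' => hj h'.2⟩
  · right
    exact ⟨fun h' => hi h'.1, fun h' => hi h'.1⟩

/-- axis-separation only depends on the region. [folklore] -/
theorem axisSep_congr {W W' : ℤ → ℤ → Prop} (h : ∀ i j, W i j ↔ W' i j) (hW : AxisSep W) : AxisSep W' := by
  intro i j hij
  rcases hW i j (fun h' => hij ((h i j).mp h')) with ⟨h1, h2⟩ | ⟨h1, h2⟩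
  · exact Or.inl ⟨fun h' => h1 ((h _ _).mpr h'), fun h' => h2 ((h _ _).mpr h')⟩
  · exact Or.inr ⟨fun h' => h1 ((h _ _).mpr h'), fun h' => h2 ((h _ _).mpr h')⟩

/-- the quadrant `{i < 0} × {j < 0}` is axis-separated (likewise the other three, by `axisSep_prod`). [folklore] -/
theorem axisSep_quadrant : AxisSep (fun i j => i < 0 ∧ j < 0) := axisSep_prod _ _

/-- the half-plane `{j < 0}` is axis-separated. [folklore] -/
theorem axisSep_halfplane : AxisSep (fun _ j => j < 0) :=
  axisSep_congr (fun i j => by simp) (axisSep_prod (fun _ => True) (fun j => j < 0))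

/-- the whole plane is axis-separated (vacuously). [folklore] -/
theorem axisSep_univ : AxisSep (fun _ _ => True) := fun _ _ h => absurd trivial h

/-- the indicator of `W`. [folklore] -/
def indW (W : ℤ → ℤ → Prop) [∀ i j, Decidable (W i j)] (i j : ℤ) : ℝ := if W i j then 1 else 0

section W

variable (W : ℤ → ℤ → Prop) [∀ i j, Decidable (W i j)]

/-- `0 ≤ indW ≤ 1`. [folklore] -/
theorem indW_mem (i j : ℤ) : 0 ≤ indW W i j ∧ indW W i j ≤ 1 := by
  unfold indW; split_ifs <;> norm_num

/-- for `z` vanishing off an axis-separated `W`, `𝟙_W` satisfies the axis condition of §1. [folklore] -/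
theorem axis_cond_of_supp (hW : AxisSep W) {z : ℤ → ℤ → ℂ} (hz : ∀ i j, ¬ W i j → z i j = 0) (i j : ℤ) :
    indW W i j = 1 ∨ (indW W i j = 0 ∧ (d1 z i j = 0 ∨ d2 z i j = 0)) := by
  unfold indW
  by_cases h : W i j
  · left; rw [if_pos h]
  · right
    refine ⟨by rw [if_neg h], ?_⟩
    rcases hW i j h with ⟨h1, h2⟩ | ⟨h1, h2⟩
    · left; rw [d1, hz _ _ h, hz _ _ h1, hz _ _ h2]; ring
    · right; rw [d2, hz _ _ h, hz _ _ h1, hz _ _ h2]; ring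

end W

/-! ## §3 The plateau cut-off -/

/-- the plateau cut-off at scale `L`: `bump L i j = (1 − η_L i)(1 − η_L j)`. [folklore] -/
def bump (L : ℕ) (i j : ℤ) : ℝ := (1 - eta L i) * (1 - eta L j)

variable {L : ℕ}

/-- `0 ≤ bump ≤ 1`. [folklore] -/
theorem bump_mem (hL : 1 ≤ L) (i j : ℤ) : 0 ≤ bump L i j ∧ bump L i j ≤ 1 := by
  obtain ⟨a0, a1⟩ := eta_mem hL i
  obtain ⟨b0, b1⟩ := eta_mem hL j
  unfold bump
  constructor
  · exact mul_nonneg (by linarith) (by linarith)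
  · calc (1 - eta L i) * (1 - eta L j) ≤ 1 * 1 := mul_le_mul (by linarith) (by linarith) (by linarith) zero_le_one
      _ = 1 := one_mul 1

/-- `bump = 1` on `Q_{2L}`. [folklore] -/
theorem bump_eq_one {i j : ℤ} (hi : tIdx i ≤ 2 * (L : ℤ)) (hj : tIdx j ≤ 2 * (L : ℤ)) : bump L i j = 1 := by
  rw [bump, eta_eq_zero hi, eta_eq_zero hj]; ring

/-- `bump = 0` off `Q_{4L−1}`. [folklore] -/
theorem bump_eq_zero (hL : 1 ≤ L) {i j : ℤ} (h : 4 * (L : ℤ) ≤ tIdx i ∨ 4 * (L : ℤ) ≤ tIdx j) : bump L i j = 0 := by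
  rcases h with h | h
  · rw [bump, eta_eq_one hL h]; ring
  · rw [bump, eta_eq_one hL h]; ring

/-- `|δ₁ bump| ≤ 1/L`, both orientations. [folklore] -/
theorem abs_bump_sub_le₁ (hL : 1 ≤ L) (i j : ℤ) :
    |bump L (i + 1) j - bump L i j| ≤ 1 / (L : ℝ) ∧ |bump L (i - 1) j - bump L i j| ≤ 1 / (L : ℝ) := by
  obtain ⟨b0, b1⟩ := eta_mem hL j
  have hg : |1 - eta L j| ≤ 1 := by rw [abs_le]; constructor <;> linarith
  have key : ∀ i' : ℤ, |bump L (i' + 1) j - bump L i' j| ≤ 1 / (L : ℝ) := by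
    intro i'
    have e : bump L (i' + 1) j - bump L i' j = -(eta L (i' + 1) - eta L i') * (1 - eta L j) := by unfold bump; ring
    rw [e, abs_mul, abs_neg]
    calc |eta L (i' + 1) - eta L i'| * |1 - eta L j| ≤ 1 / (L : ℝ) * 1 :=
          mul_le_mul (abs_eta_sub_le hL i') hg (abs_nonneg _) (by positivity)
      _ = 1 / (L : ℝ) := mul_one _
  refine ⟨key i, ?_⟩
  have h := key (i - 1)
  rwa [sub_add_cancel, abs_sub_comm] at h

/-- `|δ₂ bump| ≤ 1/L`, both orientations. [folklore] -/
theorem abs_bump_sub_le₂ (hL : 1 ≤ L) (i j : ℤ) :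
    |bump L i (j + 1) - bump L i j| ≤ 1 / (L : ℝ) ∧ |bump L i (j - 1) - bump L i j| ≤ 1 / (L : ℝ) := by
  obtain ⟨b0, b1⟩ := eta_mem hL i
  have hg : |1 - eta L i| ≤ 1 := by rw [abs_le]; constructor <;> linarith
  have key : ∀ j' : ℤ, |bump L i (j' + 1) - bump L i j'| ≤ 1 / (L : ℝ) := by
    intro j'
    have e : bump L i (j' + 1) - bump L i j' = (1 - eta L i) * -(eta L (j' + 1) - eta L j') := by unfold bump; ring
    rw [e, abs_mul, abs_neg]
    calc |1 - eta L i| * |eta L (j' + 1) - eta L j'| ≤ 1 * (1 / (L : ℝ)) :=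
          mul_le_mul hg (abs_eta_sub_le hL j') (abs_nonneg _) zero_le_one
      _ = 1 / (L : ℝ) := one_mul _
  refine ⟨key j, ?_⟩
  have h := key (j - 1)
  rwa [sub_add_cancel, abs_sub_comm] at h

/-- `|δ₁² bump| ≤ 1/L²` and `|δ₂² bump| ≤ 1/L²`. [folklore] -/
theorem abs_bump_dd_le (hL : 1 ≤ L) (i j : ℤ) :
    |bump L (i + 1) j - 2 * bump L i j + bump L (i - 1) j| ≤ 1 / (L : ℝ) ^ 2
      ∧ |bump L i (j + 1) - 2 * bump L i j + bump L i (j - 1)| ≤ 1 / (L : ℝ) ^ 2 := by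
  obtain ⟨a0, a1⟩ := eta_mem hL i
  obtain ⟨b0, b1⟩ := eta_mem hL j
  have hgi : |1 - eta L i| ≤ 1 := by rw [abs_le]; constructor <;> linarith
  have hgj : |1 - eta L j| ≤ 1 := by rw [abs_le]; constructor <;> linarith
  constructor
  · have e : bump L (i + 1) j - 2 * bump L i j + bump L (i - 1) j
        = -(eta L (i + 1) - 2 * eta L i + eta L (i - 1)) * (1 - eta L j) := by unfold bump; ring
    rw [e, abs_mul, abs_neg]
    calc _ ≤ 1 / (L : ℝ) ^ 2 * 1 := mul_le_mul (abs_eta_dd_le hL i) hgj (abs_nonneg _) (by positivity)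
      _ = _ := mul_one _
  · have e : bump L i (j + 1) - 2 * bump L i j + bump L i (j - 1)
        = (1 - eta L i) * -(eta L (j + 1) - 2 * eta L j + eta L (j - 1)) := by unfold bump; ring
    rw [e, abs_mul, abs_neg]
    calc _ ≤ 1 * (1 / (L : ℝ) ^ 2) := mul_le_mul hgi (abs_eta_dd_le hL j) (abs_nonneg _) zero_le_one
      _ = _ := one_mul _

/-! ## §4 The local `H²` estimate at an axis-separated vertex -/

section Local

variable (W : ℤ → ℤ → Prop) [∀ i j, Decidable (W i j)] (U : ℤ → ℤ → ℂ)

/-- **THE LOCAL `H²` ESTIMATE** (model, lattice units): for `1 ≤ L`, `W` axis-separated, `U = 0` off `W` on `Q_{4L}` and `lap U = G` on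
`Q_{4L+1} ∩ W`:
`Σ_{Q_{2L−1}} 𝟙_W·(|∂₁²U|² + |∂₂²U|²) ≤ 2·Σ_{Q_{4L+1}} 𝟙_W·|G|² + (32/L²)·Ẽ_{4L+1} + (16/L⁴)·Σ_{Q_{4L+1}}|U|²`. [folklore] -/
theorem local_hessian_le (hL : 1 ≤ L) (hW : AxisSep W) (G : ℤ → ℤ → ℂ)
    (hUW : ∀ i j : ℤ, tIdx i ≤ 4 * (L : ℤ) → tIdx j ≤ 4 * (L : ℤ) → ¬ W i j → U i j = 0)
    (hEq : ∀ i j : ℤ, tIdx i ≤ 4 * (L : ℤ) + 1 → tIdx j ≤ 4 * (L : ℤ) + 1 → W i j → lap U i j = G i j) :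
    sqSum (fun i j => indW W i j * (‖d1 U i j‖ ^ 2 + ‖d2 U i j‖ ^ 2)) (2 * L - 1)
      ≤ 2 * sqSum (fun i j => indW W i j * ‖G i j‖ ^ 2) (4 * L + 1)
        + 32 / (L : ℝ) ^ 2 * Et U (4 * L + 1) + 16 / (L : ℝ) ^ 4 * sqSum (fun i j => ‖U i j‖ ^ 2) (4 * L + 1) := by
  set K : ℕ := 4 * L + 1 with hK
  have hK1 : 1 ≤ K := by omega
  have hL0 : (0 : ℝ) < L := by exact_mod_cast hL
  -- the cut-off field and its support
  set z : ℤ → ℤ → ℂ := fun i j => (bump L i j : ℂ) * U i j with hz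
  have hzW : ∀ i j, ¬ W i j → z i j = 0 := by
    intro i j h
    by_cases hb : 4 * (L : ℤ) ≤ tIdx i ∨ 4 * (L : ℤ) ≤ tIdx j
    · simp only [hz, bump_eq_zero hL hb, Complex.ofReal_zero, zero_mul]
    · simp only [not_or, not_le] at hb
      simp only [hz, hUW i j (by omega) (by omega) h, mul_zero]
  have hzout : ∀ i j : ℤ, (i < -(K : ℤ) + 2 ∨ -(K : ℤ) + ((2 * K - 1 : ℕ) : ℤ) - 1 ≤ i ∨ j < -(K : ℤ) + 2 ∨ -(K : ℤ) + ((2 * K - 1 : ℕ) : ℤ) - 1 ≤ j)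
      → z i j = 0 := by
    intro i j h
    have hNz : ((2 * K - 1 : ℕ) : ℤ) = 2 * (K : ℤ) - 1 := by omega
    rw [hNz] at h
    have hout : 4 * (L : ℤ) ≤ tIdx i ∨ 4 * (L : ℤ) ≤ tIdx j := by
      unfold tIdx; split_ifs <;> omega
    simp only [hz, bump_eq_zero hL hout, Complex.ofReal_zero, zero_mul]
  -- §1–§2: the `H²` inequality for `z` with `χ = 𝟙_W` on the box `Q_K`
  have hH := hessian_le_of_axis z (indW W) (-(K : ℤ)) (2 * K - 1) hzout (axis_cond_of_supp W hW hzW)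
  have e2K : 2 * K - 1 + 1 = 2 * K := by omega
  rw [e2K] at hH
  change sqSum (fun i j => indW W i j * (‖d1 z i j‖ ^ 2 + ‖d2 z i j‖ ^ 2)) K
    ≤ sqSum (fun i j => indW W i j * ‖lap z i j‖ ^ 2) K at hH
  -- (1) on `Q_{2L−1}` the second differences of `z` are those of `U`
  have hplateau : sqSum (fun i j => indW W i j * (‖d1 U i j‖ ^ 2 + ‖d2 U i j‖ ^ 2)) (2 * L - 1)
      ≤ sqSum (fun i j => indW W i j * (‖d1 z i j‖ ^ 2 + ‖d2 z i j‖ ^ 2)) K := by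
    set f : ℤ → ℤ → ℝ := fun i j =>
      if tIdx i ≤ 2 * (L : ℤ) - 1 ∧ tIdx j ≤ 2 * (L : ℤ) - 1 then indW W i j * (‖d1 U i j‖ ^ 2 + ‖d2 U i j‖ ^ 2) else 0 with hf
    have hfv : sqSum f K = sqSum f (2 * L - 1) :=
      sqSum_eq_of_vanish f (by omega) fun i j h => by
        rw [hf]; simp only
        rw [if_neg]
        push_cast [Nat.cast_sub (by omega : 1 ≤ 2 * L)] at h ⊢
        omega
    have hf1 : sqSum (fun i j => indW W i j * (‖d1 U i j‖ ^ 2 + ‖d2 U i j‖ ^ 2)) (2 * L - 1) = sqSum f (2 * L - 1) := by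
      refine sum_congr rfl fun t ht => sum_congr rfl fun s hs => ?_
      have ht' := mem_range.mp ht
      have hs' := mem_range.mp hs
      rw [hf]; simp only
      rw [if_pos]
      constructor <;> (unfold tIdx; split_ifs <;> push_cast [Nat.cast_sub (by omega : 1 ≤ 2 * L)] <;> omega)
    rw [hf1, ← hfv]
    refine sqSum_le_of_le (fun i j => ?_) K
    rw [hf]; simp only
    split_ifs with hp
    · refine le_of_eq ?_
      obtain ⟨t1, t2, t3, t4⟩ := tIdx_step i
      obtain ⟨s1, s2, s3, s4⟩ := tIdx_step j
      have c0 : bump L i j = 1 := bump_eq_one (by omega) (by omega)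
      have c1 : bump L (i + 1) j = 1 := bump_eq_one (by omega) (by omega)
      have c2 : bump L (i - 1) j = 1 := bump_eq_one (by omega) (by omega)
      have c3 : bump L i (j + 1) = 1 := bump_eq_one (by omega) (by omega)
      have c4 : bump L i (j - 1) = 1 := bump_eq_one (by omega) (by omega)
      simp only [hz, d1, d2, c0, c1, c2, c3, c4, Complex.ofReal_one, one_mul]
    · exact mul_nonneg (indW_mem W i j).1 (add_nonneg (sq_nonneg _) (sq_nonneg _))
  -- (2) on `W`: `|Δz|² ≤ 2|G|² + 2|comm|²`
  set comm : ℤ → ℤ → ℂ := fun i j => lap z i j - (bump L i j : ℂ) * lap U i j with hcomm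
  have hrhs : sqSum (fun i j => indW W i j * ‖lap z i j‖ ^ 2) K
      ≤ sqSum (fun i j => 2 * (indW W i j * ‖G i j‖ ^ 2) + 2 * ‖comm i j‖ ^ 2) K := by
    refine sum_le_sum fun t ht => sum_le_sum fun s hs => ?_
    have ht' := mem_range.mp ht
    have hs' := mem_range.mp hs
    show indW W (-(K : ℤ) + s) (-(K : ℤ) + t) * ‖lap z (-(K : ℤ) + s) (-(K : ℤ) + t)‖ ^ 2
      ≤ 2 * (indW W (-(K : ℤ) + s) (-(K : ℤ) + t) * ‖G (-(K : ℤ) + s) (-(K : ℤ) + t)‖ ^ 2) + 2 * ‖comm (-(K : ℤ) + s) (-(K : ℤ) + t)‖ ^ 2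
    unfold indW
    split_ifs with hq
    · rw [one_mul, one_mul]
      have hG : lap U (-(K : ℤ) + s) (-(K : ℤ) + t) = G (-(K : ℤ) + s) (-(K : ℤ) + t) :=
        hEq _ _ (by unfold tIdx; split_ifs <;> omega) (by unfold tIdx; split_ifs <;> omega) hq
      have hdec : lap z (-(K : ℤ) + s) (-(K : ℤ) + t)
          = (bump L (-(K : ℤ) + s) (-(K : ℤ) + t) : ℂ) * G (-(K : ℤ) + s) (-(K : ℤ) + t) + comm (-(K : ℤ) + s) (-(K : ℤ) + t) := by
        simp only [hcomm, hG]; ring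
      rw [hdec]
      obtain ⟨c0, c1⟩ := bump_mem hL (-(K : ℤ) + s) (-(K : ℤ) + t)
      set a := (bump L (-(K : ℤ) + s) (-(K : ℤ) + t) : ℂ) * G (-(K : ℤ) + s) (-(K : ℤ) + t) with ha
      set b := comm (-(K : ℤ) + s) (-(K : ℤ) + t) with hb'
      have hn1 : ‖a‖ ≤ ‖G (-(K : ℤ) + s) (-(K : ℤ) + t)‖ := by
        rw [ha, norm_mul, Complex.norm_real, Real.norm_eq_abs, abs_of_nonneg c0]
        exact mul_le_of_le_one_left (norm_nonneg _) c1
      have hadd := norm_add_le a b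
      have h0 := norm_nonneg (a + b)
      have hsq : ‖a + b‖ ^ 2 ≤ (‖a‖ + ‖b‖) ^ 2 := pow_le_pow_left₀ h0 hadd 2
      nlinarith [norm_nonneg b, norm_nonneg a, norm_nonneg (G (-(K : ℤ) + s) (-(K : ℤ) + t)), sq_nonneg (‖a‖ - ‖b‖), hn1]
    · rw [zero_mul, zero_mul, mul_zero, zero_add]; positivity
  -- (3) the commutator, pointwise and summed
  have hcpt : ∀ i j, ‖comm i j‖ ^ 2 ≤ 8 * (1 / (L : ℝ)) ^ 2 * nbr U i j + 8 * (1 / (L : ℝ) ^ 2) ^ 2 * ‖U i j‖ ^ 2 := by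
    intro i j
    obtain ⟨h1, h2⟩ := abs_bump_sub_le₁ hL i j
    obtain ⟨h3, h4⟩ := abs_bump_sub_le₂ hL i j
    obtain ⟨h5, h6⟩ := abs_bump_dd_le hL i j
    have h := norm_commutator_sq_le (bump L) U i j h1 h2 h3 h4 h5 h6
    simp only [hcomm, hz, nbr]
    exact h
  have hcsum : sqSum (fun i j => ‖comm i j‖ ^ 2) K ≤ 8 / (L : ℝ) ^ 2 * (2 * Et U K) + 8 / (L : ℝ) ^ 4 * sqSum (fun i j => ‖U i j‖ ^ 2) K := by
    have h1 : sqSum (fun i j => ‖comm i j‖ ^ 2) K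
        ≤ sqSum (fun i j => 8 * (1 / (L : ℝ)) ^ 2 * nbr U i j + 8 * (1 / (L : ℝ) ^ 2) ^ 2 * ‖U i j‖ ^ 2) K := sqSum_le_of_le hcpt K
    have h2 : sqSum (fun i j => 8 * (1 / (L : ℝ)) ^ 2 * nbr U i j + 8 * (1 / (L : ℝ) ^ 2) ^ 2 * ‖U i j‖ ^ 2) K
        = 8 * (1 / (L : ℝ)) ^ 2 * sqSum (nbr U) K + 8 * (1 / (L : ℝ) ^ 2) ^ 2 * sqSum (fun i j => ‖U i j‖ ^ 2) K := by
      simp only [sqSum, sum_add_distrib, mul_sum]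
    rw [h2] at h1
    have e1 : 8 * (1 / (L : ℝ)) ^ 2 = 8 / (L : ℝ) ^ 2 := by ring
    have e2 : 8 * (1 / (L : ℝ) ^ 2) ^ 2 = 8 / (L : ℝ) ^ 4 := by ring
    rw [e1, e2] at h1
    refine h1.trans (add_le_add ?_ le_rfl)
    exact mul_le_mul_of_nonneg_left (nbr_sqSum_le U hK1) (by positivity)
  -- assemble
  have hsplit2 : sqSum (fun i j => 2 * (indW W i j * ‖G i j‖ ^ 2) + 2 * ‖comm i j‖ ^ 2) K
      = 2 * sqSum (fun i j => indW W i j * ‖G i j‖ ^ 2) K + 2 * sqSum (fun i j => ‖comm i j‖ ^ 2) K := by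
    simp only [sqSum, sum_add_distrib, mul_sum]
  have hEt0 : 0 ≤ Et U K := Et_nonneg U K
  calc sqSum (fun i j => indW W i j * (‖d1 U i j‖ ^ 2 + ‖d2 U i j‖ ^ 2)) (2 * L - 1)
      ≤ sqSum (fun i j => indW W i j * (‖d1 z i j‖ ^ 2 + ‖d2 z i j‖ ^ 2)) K := hplateau
    _ ≤ sqSum (fun i j => indW W i j * ‖lap z i j‖ ^ 2) K := hH
    _ ≤ 2 * sqSum (fun i j => indW W i j * ‖G i j‖ ^ 2) K + 2 * sqSum (fun i j => ‖comm i j‖ ^ 2) K := by rw [← hsplit2]; exact hrhs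
    _ ≤ 2 * sqSum (fun i j => indW W i j * ‖G i j‖ ^ 2) K
        + 2 * (8 / (L : ℝ) ^ 2 * (2 * Et U K) + 8 / (L : ℝ) ^ 4 * sqSum (fun i j => ‖U i j‖ ^ 2) K) := by linarith [hcsum]
    _ = _ := by ring

end Local

end Summit.QuantumFields.BalabanUV.Beta.GAN24.DirichletRingHessianLocal

end
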